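import Literature.NumberTheory.Automorphic.QuadraticLocalNormWitnessFamily
import Literature.NumberTheory.Automorphic.Liu2021.Def411WeilCarriers
import Literature.NumberTheory.GelbartRogawski1991.UnitaryDualPairThetaKernelCM
import HarnessLib

/-!
# FLOOR-0 P2 — stub LW `stub_LW_localWitness` of the sub-line `Cruxes/H413/Lines/F0_P2CELocalToGlobal.lean` (F0P2-plan (g4); crux item
# stmt-HodgeConjecture-24833 `HCCMUnconditional.H413`, socket item F0HdictE = stmt-HodgeConjecture-27455): THE LOCAL NORM WITNESS AT ONE PLACE

Cell hodgecm-mathlib (D-0151), FLOOR 0, programme P2; seat F0P2-p03 (g3) (F0P2-plan (g4) ruling 2026-08-31T02:42:11Z (d): «p03 ← GL + LW»).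
THEOREMS ONLY (no `def`, no instance, no notation, no named fact, no `sorry`); never imports a `Cruxes/…/Lines` module (s347 ∕ s380b): the
registered body of `F0P2CELocalToGlobal.StubLWLocalWitness` (sub-line v1, HOME mirror `F0/P2/F0_P2CELocalToGlobal.v1.F0P2-plan-g4.lean` 4e2632f0 :218)
is RESTATED VERBATIM as the type of `stubLW_holds`.

STATEMENT.  `L` CM, `L⁺ = maximalRealSubfield L`, `δ = imagUnit L`, `d = imagUnitSq L = δ²`; if two lines `a₁, a₂ ∈ (L⁺)ˣ` have the same local norm
class at the finite place `v` (`locF L⁺ d a₁ v = locF L⁺ d a₂ v` in `L⁺_vˣ ⧸ N(L_vˣ)`), there is a unit `x` of `L ⊗_{L⁺} L⁺_v = ∏_{w ∣ v} L_w`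
(★ `UnitaryGroup.LocalRing L v`) with `a₂⁻¹ δ = x · x̄ · a₁⁻¹ δ` (`x̄ = conjLocal x`) — the `hx` shape consumed by the local line transport (stub LT).

PROOF — the place-`v` component of ★ `exists_localRing_units_lineDelta_eq` (which asks the class equality at EVERY place; here only `v` is given,
so its construction is re-run at the single place): `t := a₂⁻¹ a₁` is a local norm at `v` (`QuotientGroup.eq`), i.e. `t = p² − d q²` with
`p, q ∈ L⁺_v` (★ `mem_quadraticNormSubgroup_iff`); `X := ι_v p + ι_v q · δ` (★ `quadraticLocalMap`) has `X · X̄ = ι_v t` (★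
`quadraticLocalMap_mul_conjLocal`), hence is a unit (`t ≠ 0`), and `a₂⁻¹ δ = t · a₁⁻¹ δ = X X̄ · a₁⁻¹ δ` (★ `toLocalRing_coe`).  No Hasse principle.
`--supports stmt-HodgeConjecture-24833 --as helper`.  HC_CM is proved only modulo the printed citations until rung 0 closes; this file discharges none.

## References
* [Omeara1963] O. T. O'Meara, *Introduction to Quadratic Forms* (1963): §63 Example 63:14, §65A Example 65:2.
* [Liu2021] Y. Liu, Camb. J. Math. 9 (2021) = arXiv:2102.11518: App. D §D.1 Step 1 (l. 5217), Lem. D.1 (3).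
* [CasselsFrohlichANT1967] J. W. S. Cassels, A. Fröhlich (eds.), *Algebraic Number Theory* (1967), Ch. II §§10–11.
-/

set_option autoImplicit false
-- the mandated namespace has the single-problem summit's repeated segment (`HodgeConjecture.HodgeConjecture`)
set_option linter.dupNamespace false

noncomputable section

open NumberField IsDedekindDomain

namespace Summit.HodgeConjecture.HodgeConjecture.Cruxes.H413.F0P2eStubLWLocalWitness

open Literature.NumberTheory Literature.NumberTheory.Automorphic Literature.NumberTheory.Automorphic.UnitaryGroup
open Literature.NumberTheory.Automorphic.Liu2021 Literature.NumberTheory.Automorphic.Liu2021.Def411WeilCarriers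
open Literature.NumberTheory.GelbartRogawski1991 Literature.NumberTheory.GelbartRogawski1991.UnitaryDualPair
open Literature.NumberTheory.QuadraticForms

/-- **stub LW — the local norm witness at ONE place** (registered body of `F0P2CELocalToGlobal.StubLWLocalWitness` verbatim): equal local norm
classes of `a₁, a₂` at `v` give a unit `x ∈ (∏_{w ∣ v} L_w)ˣ` with `a₂⁻¹ δ = x x̄ a₁⁻¹ δ`.  Single-place re-run of ★ `exists_localRing_units_lineDelta_eq`'s
construction (`x := ι_v p + ι_v q·δ` for `a₂⁻¹ a₁ = p² − δ² q²`). [cite: Omeara1963, §63 Ex. 63:14, §65A Ex. 65:2] [cite: Liu2021, App. D §D.1 Step 1 (l. 5217), Lem D.1 (3)] -/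
theorem stubLW_holds :
    ∀ (L : Type) [Field L] [NumberField L] [IsCMField L] (a₁ a₂ : (↥(maximalRealSubfield L))ˣ)
      (v : HeightOneSpectrum (𝓞 ↥(maximalRealSubfield L))),
      locF (↥(maximalRealSubfield L)) (imagUnitSq L) a₁ v = locF (↥(maximalRealSubfield L)) (imagUnitSq L) a₂ v →
        ∃ x : (LocalRing L v)ˣ,
          algebraMap L (LocalRing L v) (algebraMap (↥(maximalRealSubfield L)) L (↑a₂⁻¹ : ↥(maximalRealSubfield L)) * imagUnit L) =
          (x : LocalRing L v) * conjLocal L (IsCMField.complexConj L) v x *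
            algebraMap L (LocalRing L v) (algebraMap (↥(maximalRealSubfield L)) L (↑a₁⁻¹ : ↥(maximalRealSubfield L)) * imagUnit L) := by
  intro L _ _ _ a₁ a₂ v h
  -- abbreviations
  have hσδ : (IsCMField.complexConj L : L ≃ₐ[↥(maximalRealSubfield L)] L) (imagUnit L) = -imagUnit L := complexConj_imagUnit L
  have hdd : imagUnit L * imagUnit L = algebraMap ↥(maximalRealSubfield L) L (imagUnitSq L) := imagUnit_mul_self L
  -- `t := a₂⁻¹ a₁` is a local norm at `v`
  have ht : Units.map (algebraMap ↥(maximalRealSubfield L) (v.adicCompletion ↥(maximalRealSubfield L))).toMonoidHom (a₂⁻¹ * a₁) ∈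
      quadraticNormSubgroup (v.adicCompletion ↥(maximalRealSubfield L))
        (algebraMap ↥(maximalRealSubfield L) (v.adicCompletion ↥(maximalRealSubfield L)) (imagUnitSq L)) := by
    rw [map_mul, map_inv]
    rw [locF_apply, locF_apply] at h
    exact QuotientGroup.eq.1 h.symm
  obtain ⟨p, q, hpq⟩ := mem_quadraticNormSubgroup_iff.1 ht
  -- the same identity with the coercions `L⁺ → L⁺_v` spelt as `(↑)` (Mathlib `algebraMap_adicCompletion` is `rfl`)
  have hpq' : p ^ 2 - (((imagUnitSq L : ↥(maximalRealSubfield L))) : v.adicCompletion ↥(maximalRealSubfield L)) * q ^ 2 =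
      ((((a₂⁻¹ * a₁ : (↥(maximalRealSubfield L))ˣ) : ↥(maximalRealSubfield L)) :
        v.adicCompletion ↥(maximalRealSubfield L))) := hpq
  -- the witness `X := ι_v p + ι_v q · δ` and its norm
  set X : LocalRing L v := quadraticLocalMap L v (imagUnit L) (p, q) with hXdef
  have hN : X * conjLocal L (IsCMField.complexConj L) v X =
      toLocalRing L v ((((a₂⁻¹ * a₁ : (↥(maximalRealSubfield L))ˣ) : ↥(maximalRealSubfield L)) :
        v.adicCompletion ↥(maximalRealSubfield L))) := by
    rw [hXdef, quadraticLocalMap_mul_conjLocal L (IsCMField.complexConj L) hσδ hdd v p q, hpq']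
  have ht0 : ((((a₂⁻¹ * a₁ : (↥(maximalRealSubfield L))ˣ) : ↥(maximalRealSubfield L)) :
      v.adicCompletion ↥(maximalRealSubfield L))) ≠ 0 := fun h0 => by
    have h1 := HeightOneSpectrum.valuedAdicCompletion_eq_valuation' v
      (((a₂⁻¹ * a₁ : (↥(maximalRealSubfield L))ˣ) : ↥(maximalRealSubfield L)))
    rw [h0, map_zero] at h1
    exact (Valuation.ne_zero_iff _).2 (a₂⁻¹ * a₁).ne_zero h1.symm
  have hNu : IsUnit (toLocalRing L v ((((a₂⁻¹ * a₁ : (↥(maximalRealSubfield L))ˣ) : ↥(maximalRealSubfield L)) :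
      v.adicCompletion ↥(maximalRealSubfield L)))) := (IsUnit.mk0 _ ht0).map _
  have hXu : IsUnit X := isUnit_of_mul_isUnit_left (hN.symm ▸ hNu)
  refine ⟨hXu.unit, ?_⟩
  rw [IsUnit.unit_spec]
  -- `a₂⁻¹ δ = (a₂⁻¹ a₁) · (a₁⁻¹ δ)` in `L`, then push through `ι_v`
  have e1 : algebraMap ↥(maximalRealSubfield L) L (↑a₂⁻¹ : ↥(maximalRealSubfield L)) * imagUnit L =
      algebraMap ↥(maximalRealSubfield L) L ((a₂⁻¹ * a₁ : (↥(maximalRealSubfield L))ˣ) : ↥(maximalRealSubfield L)) *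
        (algebraMap ↥(maximalRealSubfield L) L (↑a₁⁻¹ : ↥(maximalRealSubfield L)) * imagUnit L) := by
    rw [Units.val_mul, map_mul, ← mul_assoc, mul_assoc (algebraMap ↥(maximalRealSubfield L) L (↑a₂⁻¹ : ↥(maximalRealSubfield L))),
      ← map_mul, Units.mul_inv, map_one, mul_one]
  rw [e1, map_mul, hN, toLocalRing_coe]

end Summit.HodgeConjecture.HodgeConjecture.Cruxes.H413.F0P2eStubLWLocalWitness
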